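import Literature.RepresentationTheory.Virasoro.VermaModule

/-!
# Weight-space decomposition of highest-weight Virasoro modules

For a representation `V` of the Virasoro algebra generated by a primary vector `w` of weight `h`
(a highest-weight module in the sense of Iohara–Koga Definition 1.16, `w = 0` allowed) we prove the
standard grading statements (Iohara–Koga §1.2.5–1.2.6, Kytölä–Ridout §2 around eq. (2.8),
Di Francesco–Mathieu–Sénéchal §7.1.1):

* **straightening** (`VirasoroRep.L_neg_mem_levelSpace`): `L_{-k}` (`k ≥ 1`) maps the span
  `levelSpace w N` of the ORDERED PBW monomials `e_𝕀 w = L_{-k₁} ⋯ L_{-k_j} w`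
  (`k₁ ≥ ⋯ ≥ k_j ≥ 1`, `𝕀 = (k₁, …, k_j) ⊢ N`) into `levelSpace w (N + k)` — the reordering
  `L_{-k} L_{-a} = L_{-a} L_{-k} + (a - k) L_{-(a+k)}` by induction on the level;
* hence every word `L_{-k₁} ⋯ L_{-k_j} w` (any order, `k_i ≥ 0`) lies in `⨁_N levelSpace w N`, and
  `V = Σ_N levelSpace w N` (`iSup_levelSpace_eq_top`);
* since `levelSpace w N ⊆ V_{h+N}` and generalised eigenspaces of `L_0` for distinct eigenvalues are
  independent: `V_{h+N} = ker (L_0 - h - N) = ⋃ₖ ker (L_0 - h - N)ᵏ = levelSpace w N`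
  (`genWeightSpace_eq_levelSpace`, `weightSpace_eq_levelSpace`), all other generalised weight
  spaces vanish (`genWeightSpace_eq_bot`), `L_0` is diagonalisable (`isWeightModule_of_generated`),
  every weight space is finite-dimensional and **`dim V_{h+N} ≤ p(N)`** (`gradedDim_le_card`);
* the specialisations to the Verma module `V(c,h)` (`Verma.gradedDim_le`: `dim V(c,h)_{h+N} ≤ p(N)`,
  the spanning half of `dim = p(N)`, Kytölä–Ridout (2.8)) and to the Kac quotients `K_{r,s}`
  (`KacModule.gradedDim_le`).

## Not here

The reverse inequality `dim V(c,h)_{h+N} ≥ p(N)` (linear independence of the PBW monomials, the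
PBW theorem), which needs a faithful enough concrete representation (Fock modules).
-/

noncomputable section

namespace Literature.RepresentationTheory.Virasoro

namespace VirasoroRep

variable {c : ℂ} {V : Type*} [AddCommGroup V] [Module ℂ V] (R : VirasoroRep c V)

/-! ### Level spaces: the span of the ordered PBW monomials of a given level -/

/-- The **level-`N` descendant space** of a vector `w`: the span of the ordered PBW monomials
`e_𝕀 w = L_{-k₁} ⋯ L_{-k_j} w`, `k₁ ≥ ⋯ ≥ k_j ≥ 1`, over the partitions `𝕀 = (k₁,…,k_j) ⊢ N`
(for the highest-weight vector of a highest-weight module this is the weight space `V_{h+N}`,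
`weightSpace_eq_levelSpace`). [cite: IoharaKoga2011, §4.4.2 (the basis e_𝕀.v_{c,h}, 𝕀 ∈ 𝒫ₙ, of M(c,h)_{h+n})]
[cite: KytolaRidout2009, §2 (before eq. (2.8))] -/
def levelSpace (w : V) (N : ℕ) : Submodule ℂ V :=
  Submodule.span ℂ (Set.range fun p : Nat.Partition N => R.partitionVector p w)

/-- `e_𝕀 w ∈ levelSpace w N` for `𝕀 ⊢ N`. [folklore] -/
theorem partitionVector_mem_levelSpace (w : V) {N : ℕ} (p : Nat.Partition N) :
    R.partitionVector p w ∈ R.levelSpace w N :=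
  Submodule.subset_span ⟨p, rfl⟩

/-- The word of a partition (parts in decreasing order) is decreasing, positive, of sum `N`, and
`e_𝕀 w` is the corresponding PBW word. [folklore] -/
theorem exists_list_of_partition (w : V) {N : ℕ} (p : Nat.Partition N) :
    ∃ l : List ℕ, l.Pairwise (· ≥ ·) ∧ (∀ j ∈ l, 0 < j) ∧ l.sum = N ∧
      R.partitionVector p w = R.pbwVector l w := by
  refine ⟨(p.parts.sort (· ≤ ·)).reverse, ?_, ?_, ?_, rfl⟩
  · exact List.pairwise_reverse.mpr (Multiset.pairwise_sort p.parts (· ≤ ·))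
  · intro j hj
    rw [List.mem_reverse, Multiset.mem_sort] at hj
    exact p.parts_pos hj
  · rw [List.sum_reverse, ← Multiset.sum_coe, Multiset.sort_eq, p.parts_sum]

/-- Conversely a decreasing word in positive letters of total degree `N` is the word of a partition
of `N`, so `L_{-k₁} ⋯ L_{-k_j} w ∈ levelSpace w (Σ kᵢ)` for `k₁ ≥ ⋯ ≥ k_j ≥ 1`. [folklore] -/
theorem pbwVector_mem_levelSpace (w : V) {l : List ℕ} (hs : l.Pairwise (· ≥ ·))
    (hp : ∀ j ∈ l, 0 < j) : R.pbwVector l w ∈ R.levelSpace w l.sum := by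
  let p : Nat.Partition l.sum :=
    ⟨(l : Multiset ℕ), fun hi => hp _ (Multiset.mem_coe.mp hi), Multiset.sum_coe l⟩
  have hsort : p.parts.sort (· ≤ ·) = l.reverse := by
    refine List.Perm.eq_of_pairwise' (r := (· ≤ ·)) (Multiset.pairwise_sort p.parts (· ≤ ·))
      (List.pairwise_reverse.mpr hs) ?_
    exact Multiset.coe_eq_coe.mp ((Multiset.sort_eq _ _).trans (Multiset.coe_reverse l).symm)
  have h1 := R.partitionVector_mem_levelSpace w p
  rwa [partitionVector, hsort, List.reverse_reverse] at h1

/-- **Straightening.** `L_{-k}` (`k ≥ 1`) maps the level-`N` space of ordered monomials on `w` into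
the level-`(N + k)` space: if `k` is at least the largest part one just prepends `L_{-k}`; otherwise
`L_{-k} L_{-a} = L_{-a} L_{-k} + (a - k) L_{-(k+a)}` (no central term as `k + a ≠ 0`) and both terms
have been straightened at a lower level (induction on `N`). Valid for ANY vector `w`.
[cite: DiFrancescoMathieuSenechal1997, §7.1.1 (reordering of the L_{-k} by the commutation relations, before eq. (7.10))]
[cite: IoharaKoga2011, §4.4.2] -/
theorem L_neg_mem_levelSpace (w : V) (N : ℕ) :
    ∀ (k : ℕ), 0 < k → ∀ x ∈ R.levelSpace w N, R.L (-(k : ℤ)) x ∈ R.levelSpace w (N + k) := by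
  induction N using Nat.strong_induction_on with
  | _ N ih =>
  intro k hk x hx
  induction hx using Submodule.span_induction with
  | mem x hx =>
    obtain ⟨p, rfl⟩ := hx
    obtain ⟨l, hs, hpos, hsum, hl⟩ := R.exists_list_of_partition w p
    dsimp only
    rw [hl]
    subst hsum
    cases l with
    | nil =>
      have h1 := R.pbwVector_mem_levelSpace w (l := [k]) (List.pairwise_singleton _ _)
        (by simpa using hk)
      simpa using h1
    | cons a l =>
      rw [List.pairwise_cons] at hs
      by_cases hka : a ≤ k
      · -- prepend: `k :: a :: l` is still decreasing
        have hs' : (k :: a :: l).Pairwise (· ≥ ·) := by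
          refine List.pairwise_cons.mpr ⟨fun b hb => ?_, List.pairwise_cons.mpr hs⟩
          rcases List.mem_cons.mp hb with rfl | hb
          · exact hka
          · exact (hs.1 b hb).trans hka
        have hpos' : ∀ j ∈ k :: a :: l, 0 < j := by
          intro j hj
          rcases List.mem_cons.mp hj with rfl | hj
          · exact hk
          · exact hpos j hj
        have h1 := R.pbwVector_mem_levelSpace w hs' hpos'
        rw [pbwVector_cons] at h1
        have e : (k :: a :: l).sum = (a :: l).sum + k := by simp [List.sum_cons]; omega
        rwa [e] at h1
      · -- reorder: `L_{-k} L_{-a} y = L_{-a} L_{-k} y + (a - k) L_{-(k+a)} y`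
        have hka' : k < a := Nat.lt_of_not_le hka
        have ha : 0 < a := hpos a List.mem_cons_self
        set y := R.pbwVector l w with hy_def
        have hy : y ∈ R.levelSpace w l.sum :=
          R.pbwVector_mem_levelSpace w hs.2 fun j hj => hpos j (List.mem_cons_of_mem a hj)
        have hlt : l.sum < (a :: l).sum := by rw [List.sum_cons]; omega
        -- `L_{-k} y` at level `l.sum + k < (a :: l).sum`
        have h1 : R.L (-(k : ℤ)) y ∈ R.levelSpace w (l.sum + k) := ih _ hlt k hk y hy
        have hlt' : l.sum + k < (a :: l).sum := by rw [List.sum_cons]; omega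
        have h2 : R.L (-(a : ℤ)) (R.L (-(k : ℤ)) y) ∈ R.levelSpace w (l.sum + k + a) :=
          ih _ hlt' a ha _ h1
        have h3 : R.L (-((k + a : ℕ) : ℤ)) y ∈ R.levelSpace w (l.sum + (k + a)) :=
          ih _ hlt (k + a) (by omega) y hy
        rw [pbwVector_cons, R.comm_apply (-(k : ℤ)) (-(a : ℤ)) y,
          centralTerm_of_ne c (by omega : -(k : ℤ) + -(a : ℤ) ≠ 0), zero_smul, add_zero]
        have e1 : l.sum + k + a = (a :: l).sum + k := by rw [List.sum_cons]; omega
        have e2 : l.sum + (k + a) = (a :: l).sum + k := by rw [List.sum_cons]; omega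
        have e3 : -(k : ℤ) + -(a : ℤ) = -((k + a : ℕ) : ℤ) := by push_cast; ring
        rw [e1] at h2
        rw [e2] at h3
        rw [e3]
        exact add_mem h2 (Submodule.smul_mem _ _ h3)
  | zero => rw [map_zero]; exact zero_mem _
  | add x y _ _ hx hy => rw [map_add]; exact add_mem hx hy
  | smul a x _ hx => rw [map_smul]; exact Submodule.smul_mem _ a hx

/-- `levelSpace w N ⊆ V_{μ+N}` for `w ∈ V_μ`. [cite: DiFrancescoMathieuSenechal1997, eq. (7.8)] -/
theorem levelSpace_le_weightSpace {w : V} {μ : ℂ} (hw : w ∈ R.weightSpace μ) (N : ℕ) :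
    R.levelSpace w N ≤ R.weightSpace (μ + N) := by
  refine Submodule.span_le.mpr ?_
  rintro _ ⟨p, rfl⟩
  exact R.partitionVector_mem_weightSpace hw p

/-- `L_0` acts on `levelSpace w N` by the scalar `μ + N` (for `w ∈ V_μ`). [cite: DiFrancescoMathieuSenechal1997, eq. (7.8)] -/
theorem L_zero_apply_of_mem_levelSpace {w : V} {μ : ℂ} (hw : w ∈ R.weightSpace μ) {N : ℕ} {x : V}
    (hx : x ∈ R.levelSpace w N) : R.L 0 x = (μ + N) • x :=
  Module.End.mem_eigenspace_iff.mp (R.levelSpace_le_weightSpace hw N hx)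

/-- The sum of the level spaces is stable under all `L_{-k}`, `k ≥ 0` (for `w ∈ V_μ`). [folklore] -/
theorem L_neg_mem_iSup_levelSpace {w : V} {μ : ℂ} (hw : w ∈ R.weightSpace μ) (k : ℕ) {x : V}
    (hx : x ∈ ⨆ N, R.levelSpace w N) : R.L (-(k : ℤ)) x ∈ ⨆ N, R.levelSpace w N := by
  induction hx using Submodule.iSup_induction' with
  | mem N x hx =>
    rcases Nat.eq_zero_or_pos k with rfl | hk
    · rw [Int.natCast_zero, neg_zero, R.L_zero_apply_of_mem_levelSpace hw hx]
      exact Submodule.smul_mem _ _ (Submodule.mem_iSup_of_mem N hx)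
    · exact Submodule.mem_iSup_of_mem (N + k) (R.L_neg_mem_levelSpace w N k hk x hx)
  | zero => rw [map_zero]; exact zero_mem _
  | add x y _ _ hx hy => rw [map_add]; exact add_mem hx hy

/-- Every word `L_{-k₁} ⋯ L_{-k_j} w` (any order, `kᵢ ≥ 0`) on a weight vector `w` lies in the sum of
the level spaces (is a combination of ordered monomials).
[cite: DiFrancescoMathieuSenechal1997, §7.1.1 (before eq. (7.10))] -/
theorem pbwVector_mem_iSup_levelSpace {w : V} {μ : ℂ} (hw : w ∈ R.weightSpace μ) (l : List ℕ) :
    R.pbwVector l w ∈ ⨆ N, R.levelSpace w N := by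
  induction l with
  | nil =>
    refine Submodule.mem_iSup_of_mem 0 ?_
    simpa using R.pbwVector_mem_levelSpace w (l := []) List.Pairwise.nil (by simp)
  | cons k l ih =>
    rw [pbwVector_cons]
    exact R.L_neg_mem_iSup_levelSpace hw k ih

/-- **`V = Σ_N levelSpace w N`** for a module generated by a primary vector `w`: a highest-weight
module is spanned by the ordered PBW monomials on its highest-weight vector.
[cite: IoharaKoga2011, §1.2.5–§1.2.6] [cite: KytolaRidout2009, §2 ("V_{h,c} = U⁻ v_{h,c}" and the PBW basis)] -/
theorem iSup_levelSpace_eq_top {w : V} {h : ℂ} (hw : R.IsPrimary w h) (hgen : R.generated {w} = ⊤) :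
    ⨆ N, R.levelSpace w N = ⊤ := by
  rw [eq_top_iff, ← hgen, R.generated_singleton_eq_pbwSpan hw, pbwSpan]
  refine Submodule.span_le.mpr ?_
  rintro _ ⟨l, rfl⟩
  exact R.pbwVector_mem_iSup_levelSpace hw.mem_weightSpace l

/-! ### Weight spaces of a highest-weight module -/

/-- Key linear-algebra step: a generalised `L_0`-eigenvector of eigenvalue `μ` in a module generated
by a primary `w` of weight `h` lies in the sum of the level spaces `levelSpace w N` with `h + N = μ`
(the components in the other levels lie in generalised eigenspaces of other eigenvalues, which are
independent from that of `μ`). [folklore] -/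
theorem mem_iSup_levelSpace_of_mem_genWeightSpace {w : V} {h : ℂ} (hw : R.IsPrimary w h)
    (hgen : R.generated {w} = ⊤) {μ : ℂ} {x : V} (hx : x ∈ R.genWeightSpace μ) :
    x ∈ ⨆ (N : ℕ) (_ : (h + N : ℂ) = μ), R.levelSpace w N := by
  have hind := Module.End.independent_maxGenEigenspace (R.L 0)
  have htop : x ∈ ⨆ N, R.levelSpace w N := by rw [R.iSup_levelSpace_eq_top hw hgen]; trivial
  rw [iSup_split _ (fun N : ℕ => (h + N : ℂ) = μ), Submodule.mem_sup] at htop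
  obtain ⟨y, hy, z, hz, rfl⟩ := htop
  -- `y ∈ maxGenEigenspace μ`
  have hy' : y ∈ R.genWeightSpace μ := by
    have hle : (⨆ (N : ℕ) (_ : (h + N : ℂ) = μ), R.levelSpace w N) ≤ R.genWeightSpace μ := by
      refine iSup₂_le fun N hN => ?_
      rw [← hN]
      exact (R.levelSpace_le_weightSpace hw.mem_weightSpace N).trans
        Module.End.eigenspace_le_maxGenEigenspace
    exact hle hy
  -- `z` lies in the other generalised eigenspaces
  have hz' : z ∈ ⨆ (ν : ℂ) (_ : ν ≠ μ), R.genWeightSpace ν := by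
    have hle : (⨆ (N : ℕ) (_ : ¬ (h + N : ℂ) = μ), R.levelSpace w N) ≤
        ⨆ (ν : ℂ) (_ : ν ≠ μ), R.genWeightSpace ν := by
      refine iSup₂_le fun N hN => ?_
      exact ((R.levelSpace_le_weightSpace hw.mem_weightSpace N).trans
        Module.End.eigenspace_le_maxGenEigenspace).trans (le_iSup₂_of_le (h + N : ℂ) hN le_rfl)
    exact hle hz
  have hz'' : z ∈ R.genWeightSpace μ := by
    have := sub_mem hx hy'
    rwa [add_sub_cancel_left] at this
  have hz0 : z = 0 := (Submodule.disjoint_def.mp (iSupIndep_def.mp hind μ)) z hz'' hz'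
  rw [hz0, add_zero]
  exact hy

/-- **The weight spaces of a highest-weight module are the level spaces**, even in the generalised
sense: `⋃ₖ ker (L_0 - (h+N))ᵏ = levelSpace w N`. [cite: IoharaKoga2011, §1.2.6]
[cite: KytolaRidout2009, §2 (eq. (2.8) and the sentence before it)] -/
theorem genWeightSpace_eq_levelSpace {w : V} {h : ℂ} (hw : R.IsPrimary w h)
    (hgen : R.generated {w} = ⊤) (N : ℕ) : R.genWeightSpace (h + N) = R.levelSpace w N := by
  apply le_antisymm
  · intro x hx
    have hle : (⨆ (M : ℕ) (_ : (h + M : ℂ) = h + N), R.levelSpace w M) ≤ R.levelSpace w N := by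
      refine iSup₂_le fun M hM => ?_
      have hMN : M = N := by exact_mod_cast add_left_cancel hM
      subst hMN
      exact le_rfl
    exact hle (R.mem_iSup_levelSpace_of_mem_genWeightSpace hw hgen hx)
  · exact (R.levelSpace_le_weightSpace hw.mem_weightSpace N).trans
      Module.End.eigenspace_le_maxGenEigenspace

/-- `ker (L_0 - (h+N)) = levelSpace w N`: the weight space `V_{h+N}` is spanned by the ordered
monomials `e_𝕀 w`, `𝕀 ⊢ N`. [cite: KytolaRidout2009, §2 (before eq. (2.8))]
[cite: DiFrancescoMathieuSenechal1997, §7.1.1 (eq. (7.10) and Table 7.1)] -/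
theorem weightSpace_eq_levelSpace {w : V} {h : ℂ} (hw : R.IsPrimary w h)
    (hgen : R.generated {w} = ⊤) (N : ℕ) : R.weightSpace (h + N) = R.levelSpace w N :=
  le_antisymm (Module.End.eigenspace_le_maxGenEigenspace.trans
    (R.genWeightSpace_eq_levelSpace hw hgen N).le) (R.levelSpace_le_weightSpace hw.mem_weightSpace N)

/-- Off the lattice `h + ℕ` a highest-weight module has no (generalised) weight vectors.
[cite: IoharaKoga2011, §1.2.6] -/
theorem genWeightSpace_eq_bot {w : V} {h : ℂ} (hw : R.IsPrimary w h) (hgen : R.generated {w} = ⊤)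
    {μ : ℂ} (hμ : ∀ N : ℕ, (h + N : ℂ) ≠ μ) : R.genWeightSpace μ = ⊥ := by
  rw [eq_bot_iff]
  intro x hx
  have hle : (⨆ (M : ℕ) (_ : (h + M : ℂ) = μ), R.levelSpace w M) ≤ (⊥ : Submodule ℂ V) :=
    iSup₂_le fun M hM => absurd hM (hμ M)
  exact hle (R.mem_iSup_levelSpace_of_mem_genWeightSpace hw hgen hx)

/-- A highest-weight module is a weight module (`L_0` is diagonalisable). [cite: IoharaKoga2011, §1.2.6] -/
theorem isWeightModule_of_generated {w : V} {h : ℂ} (hw : R.IsPrimary w h)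
    (hgen : R.generated {w} = ⊤) : R.IsWeightModule := by
  rw [IsWeightModule, eq_top_iff, ← R.iSup_levelSpace_eq_top hw hgen]
  exact iSup_le fun N => (R.levelSpace_le_weightSpace hw.mem_weightSpace N).trans (le_iSup _ _)

/-- The weight spaces of a highest-weight module are finite-dimensional. [cite: IoharaKoga2011, §1.2.6] -/
theorem finiteDimensional_genWeightSpace {w : V} {h : ℂ} (hw : R.IsPrimary w h)
    (hgen : R.generated {w} = ⊤) (μ : ℂ) : FiniteDimensional ℂ (R.genWeightSpace μ) := by
  by_cases hμ : ∃ N : ℕ, (h + N : ℂ) = μ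
  · obtain ⟨N, rfl⟩ := hμ
    rw [R.genWeightSpace_eq_levelSpace hw hgen N, levelSpace]
    exact FiniteDimensional.span_of_finite ℂ (Set.finite_range _)
  · rw [R.genWeightSpace_eq_bot hw hgen fun N hN => hμ ⟨N, hN⟩]
    infer_instance

/-- **`dim V_{h+N} ≤ p(N)`** for a module generated by a primary vector of weight `h` (the number of
ordered monomials of level `N` is the number of partitions of `N`).
[cite: KytolaRidout2009, eq. (2.8)] [cite: DiFrancescoMathieuSenechal1997, eq. (7.10)] -/
theorem gradedDim_le_card {w : V} {h : ℂ} (hw : R.IsPrimary w h) (hgen : R.generated {w} = ⊤)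
    (N : ℕ) : R.gradedDim (h + N) ≤ Fintype.card (Nat.Partition N) := by
  rw [gradedDim, R.genWeightSpace_eq_levelSpace hw hgen N, levelSpace]
  exact finrank_range_le_card _

/-- Off the lattice `h + ℕ` the graded dimension of a highest-weight module vanishes.
[cite: IoharaKoga2011, §1.2.6] -/
theorem gradedDim_eq_zero {w : V} {h : ℂ} (hw : R.IsPrimary w h) (hgen : R.generated {w} = ⊤)
    {μ : ℂ} (hμ : ∀ N : ℕ, (h + N : ℂ) ≠ μ) : R.gradedDim μ = 0 := by
  rw [gradedDim, R.genWeightSpace_eq_bot hw hgen hμ]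
  exact finrank_bot ℂ V

/-- The image of a generating vector generates the quotient. [folklore] -/
theorem generated_mk_eq_top {w : V} (hgen : R.generated {w} = ⊤) (W : Submodule ℂ V)
    (hW : R.IsInvariant W) :
    (R.quotient W hW).generated {Submodule.Quotient.mk w} = ⊤ := by
  set G := (R.quotient W hW).generated {Submodule.Quotient.mk (p := W) w}
  have h1 : R.generated {w} ≤ G.comap W.mkQ := by
    refine R.generated_le ?_ ?_
    · rintro _ rfl
      exact (R.quotient W hW).subset_generated _ (Set.mem_singleton _)
    · intro n x hx
      rw [Submodule.mem_comap, Submodule.mkQ_apply] at hx ⊢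
      rw [← quotient_L_mk]
      exact (R.quotient W hW).isInvariant_generated _ n _ hx
  rw [eq_top_iff]
  rintro x -
  obtain ⟨y, rfl⟩ := Submodule.Quotient.mk_surjective W x
  have hy : y ∈ G.comap W.mkQ := h1 (hgen ▸ Submodule.mem_top)
  simpa using hy

end VirasoroRep

/-! ### The Verma module and the Kac quotients -/

namespace Verma

variable {c h : ℂ}

/-- `V(c,h)_{h+N}` (even the generalised weight space) is the span of the ordered monomials
`e_𝕀 v_{c,h}`, `𝕀 ⊢ N`. [cite: KytolaRidout2009, §2 (before eq. (2.8))] [cite: IoharaKoga2011, §4.4.1] -/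
theorem genWeightSpace_eq_levelSpace (N : ℕ) :
    (rep c h).genWeightSpace (h + N) = (rep c h).levelSpace (hw c h) N :=
  (rep c h).genWeightSpace_eq_levelSpace isPrimary_hw generated_hw_eq_top N

/-- `V(c,h) = ⊕_N V(c,h)_{h+N}` with `L_0` diagonalisable. [cite: IoharaKoga2011, §4.4.1 (M(c,h) = ⊕ₙ M(c,h)_{h+n})] -/
theorem isWeightModule : (rep c h).IsWeightModule :=
  (rep c h).isWeightModule_of_generated isPrimary_hw generated_hw_eq_top

/-- **`dim V(c,h)_{h+N} ≤ p(N)`** (the spanning half of `dim V(c,h)_{h+N} = p(N)`).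
[cite: KytolaRidout2009, eq. (2.8)] [cite: DiFrancescoMathieuSenechal1997, eq. (7.10)] -/
theorem gradedDim_le (N : ℕ) : (rep c h).gradedDim (h + N) ≤ Fintype.card (Nat.Partition N) :=
  (rep c h).gradedDim_le_card isPrimary_hw generated_hw_eq_top N

/-- `V(c,h)` has no weights off `h + ℕ`. [cite: IoharaKoga2011, §4.4.1] -/
theorem gradedDim_eq_zero {μ : ℂ} (hμ : ∀ N : ℕ, (h + N : ℂ) ≠ μ) : (rep c h).gradedDim μ = 0 :=
  (rep c h).gradedDim_eq_zero isPrimary_hw generated_hw_eq_top hμ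

/-- The weight spaces of `V(c,h)` are finite-dimensional. [cite: IoharaKoga2011, §4.4.1] -/
theorem finiteDimensional_genWeightSpace (μ : ℂ) :
    FiniteDimensional ℂ ((rep c h).genWeightSpace μ) :=
  (rep c h).finiteDimensional_genWeightSpace isPrimary_hw generated_hw_eq_top μ

end Verma

namespace KacModule

variable (t : ℂ) (r s : ℕ)

/-- `K_{r,s}` is generated by `x_{r,s}`. [cite: KytolaRidout2009, §2] -/
theorem generated_hw_eq_top : (rep t r s).generated {hw t r s} = ⊤ :=
  (Verma.rep _ _).generated_mk_eq_top Verma.generated_hw_eq_top _ _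

/-- The weight spaces of `K_{r,s}` are spanned by the ordered monomials on `x_{r,s}`.
[cite: KytolaRidout2009, §2] -/
theorem genWeightSpace_eq_levelSpace (N : ℕ) :
    (rep t r s).genWeightSpace (kacWeight t r s + N) = (rep t r s).levelSpace (hw t r s) N :=
  (rep t r s).genWeightSpace_eq_levelSpace (isPrimary_hw t r s) (generated_hw_eq_top t r s) N

/-- `K_{r,s}` is a weight module. [cite: KytolaRidout2009, §2] -/
theorem isWeightModule : (rep t r s).IsWeightModule :=
  (rep t r s).isWeightModule_of_generated (isPrimary_hw t r s) (generated_hw_eq_top t r s)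

/-- `dim (K_{r,s})_{h_{r,s}+N} ≤ p(N)`. [cite: PearceRasmussenZuber2006, §2.2 (χ_{r,s} ≤ q^{Δ}/∏(1-qⁿ) coefficientwise)] -/
theorem gradedDim_le (N : ℕ) :
    (rep t r s).gradedDim (kacWeight t r s + N) ≤ Fintype.card (Nat.Partition N) :=
  (rep t r s).gradedDim_le_card (isPrimary_hw t r s) (generated_hw_eq_top t r s) N

/-- `K_{r,s}` has no weights off `h_{r,s} + ℕ`. [cite: PearceRasmussenZuber2006, §2.2] -/
theorem gradedDim_eq_zero {μ : ℂ} (hμ : ∀ N : ℕ, (kacWeight t r s + N : ℂ) ≠ μ) :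
    (rep t r s).gradedDim μ = 0 :=
  (rep t r s).gradedDim_eq_zero (isPrimary_hw t r s) (generated_hw_eq_top t r s) hμ

end KacModule

end Literature.RepresentationTheory.Virasoro

end
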